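import Literature.AnabelianGeometry.EtaleTheta.Discharge.Sec4NonVacuityThm44
import Literature.AnabelianGeometry.EtaleTheta.BiKummerThm44SubTree

/-!
# [EtTh] Theorem 4.4 (ii), (iii) as typed (`Thm44_ii`, `Thm44_iii`): schema certificates —
# the universal closures are FALSE (kernel `¬ ∀`), and the instance forms that hold

S. Mochizuki, *The étale theta function and its Frobenioid-theoretic manifestations*, Publ. RIMS **45**
(2009) [MochizukiEtTh2009], §4, Theorem 4.4 (ii), (iii), PDF p.94 (printed p.320); proof p.95.
Print, (ii): "`Ψ` induces a 1-compatible equivalence of categories `Ψ^birat : C₁^birat ⥲ C₂^birat`.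
Moreover, `Ψ` preserves fraction-pairs …"; (iii): "… `A₁` is `(N, H_{⊙,1}, f₁)`-saturated if and only if
`A₂` is `(N, H_{⊙,2}, f₂)`-saturated …" where "`f₁ ↦ f₂` via `Ψ^birat`".

abc-iut cell, block F (fact-proving wave), tranche 110, FACT-LIST rows **F-0494** (`BiKummerSetting.Thm44_ii`)
and **F-0495** (`BiKummerSetting.Thm44_iii`), both typed by abc-iut-L2-t3 in `BiKummerRoots.lean` over the
§4 hypothesis structure `BiKummerSetting` (statement file untouched; this is a PROOF-ONLY companion: theorems
only, the toy witness data being built inline in the proofs — no definition, no named fact, no instance, no `sorry`).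

## What is certified (plan R5: a parametrised schema is a fact only at named instances)

Both declarations are SCHEMATA: over two settings `S₁, S₂`, a hypothesis package `h : Thm44Hyp S₁ S₂`
(an equivalence `Ψ` with `Base ∘ Ψ ≅ Ψ^bs ∘ Base`, …) and — the decisive binder — an ARBITRARY family of
group isomorphisms `ψ_A : O^×(A^birat) ≃* O^×(Ψ(A)^birat)` standing in for print's INDUCED `Ψ^birat`;
moreover the clauses "`Div(s'), Div(s'')` have disjoint supports" (Def 4.1 (i)) and "`A''` is
`(N, H_⊙^{bs-fld})`-saturated" (Def 4.1 (iii)(a)) are FREE relation slots of `BiKummerSetting`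
(`DisjointSupports`, `IsNHSaturatedBsFld`; TODO-merge markers abc-iut-L1-t3 / abc-iut-L1-t4).

1. **Universal closures REFUTED in kernel** (at universe level `0`, over the cell's own perfect toy §4
   setting `Toy.biKummerSetting` of `Discharge/Sec4NonVacuity.lean`):
   * `not_forall_thm44_ii_psi` — already at the cell's IDENTITY hypothesis `Toy.thm44HypId` (`Ψ = 𝟭`,
     `C₁ = C₂` literally) the junk identification `ψ := inversion` kills (ii): the fraction-pair
     `(s_𝔭, id)` of the uniformiser `f_𝔭` (`Toy.exists_fractionPair_mul_self_ne_one`: `f_𝔭 · f_𝔭 ≠ 1`)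
     would have to be a fraction-pair of `f_𝔭⁻¹` with the same two arrows.  Lever = sub-DAG row T44-L10 (b)
     (`Thm44Hyp.BiratCompatible.frac`, [FrdI] Cor 4.10: `ψ` IS `Ψ^birat`), which inversion violates.
   * `not_forall_thm44_ii` — with `ψ = id` and `Ψ = 𝟭` but the target setting's free slot
     `DisjointSupports := False` (built inline): lever = T44-L12
     (`Thm44Hyp.PreservesDisjointSupports`, [FrdI] Thm 4.2 (ii)).
   * `not_forall_thm44_iii` — with `ψ = id`, `Ψ = 𝟭` and the target's free slot
     `IsNHSaturatedBsFld := False` (built inline): `A_⊙` is `(1, H_⊙, 1)`-saturated on the left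
     (`Toy.isSaturated_one`) and cannot be on the right.  Lever = T44-L15b
     (`Thm44Hyp.PreservesNHSaturatedBsFld`, [FrdII] Def 2.2 (ii) / [AbsAnab] Lem 1.3.8).
   So neither row may be bound as a closed hypothesis `(h : ∀ …, Thm44_ii …)` of a certificate — it would
   make the certificate vacuous; consumers bind the instance theorems below (none does today: grep census
   of `Literature/`, `Summits/` finds no hypothesis-consumer of either name).
2. **Instance forms that HOLD** (the repaired reading "`ψ = Ψ^birat`, slots transported"):
   `Thm44Hyp.thm44_ii_of_thm34` — (ii) for every `h, ψ` with T44-L10 (`BiratCompatible ψ`) and T44-L12, the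
   [FrdI] Thm 3.4 input T44-L03 being DERIVED from the tree's category-theoreticity theorem
   (`Thm44Hyp.preservesFrobeniusStructure_of_thm34`, `BiKummerThm44SubFrdI.lean`) under "`C_i` Frobenioids, `D_i` FSM, `Φ_i`
   non-dilating"; `Thm44Hyp.thm44_ii_treeVocab` — the same at the canonical vocabularies modulo
   {`Remark372 D₀ / D₀'`, `hBinj_i`, T44-L10, T44-L12}, exactly parallel to the tree's
   `thm44_iii_treeVocab` (`BiKummerThm44SubTree.lean`) (modulo {`Remark372`, `hBinj_i`, T44-L15b}).  Model witnesses (consistency):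
   `Toy.thm44_ii_id`, `Toy.thm44_iii_id` (`Discharge/Sec4NonVacuityThm44.lean`).
   The three levers of 1. are precisely the residual slot-hypotheses of 2.: each is NECESSARY.

HONEST FRAMING: [EtTh] is refereed, pre-IUT material; the refutations concern the TYPED schemata at junk
values of their free binders (they say "weaker-typed than print", not "print is wrong"); nothing here bears
on, or takes a side on, [IUTchIII] Cor. 3.12 or any author; typed ≠ proved.
-/

noncomputable section

namespace Literature.AnabelianGeometry.EtaleTheta

open CategoryTheory Opposite Function Literature.AlgebraicGeometry.Frobenioids
open scoped NNRat

namespace Toy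

/-- `B(A_⊙^bs)` of the perfect toy is group-like (every element a unit; `B₀^Λ = ℤ` is).
[cite: MochizukiEtTh2009, Def 3.6 p.77] -/
theorem isUnit_ratFn_Aodot : ∀ b : temperedFrobenioidQ.ratFnFunctor.obj (op Aodot.base), IsUnit b :=
  temperedFrobenioidQ.isUnit_ratFnFunctor realifiedQ.isUnit_BΛ Aodot

/-- In the toy, `Base = 𝟭 : D → D₀` is the inclusion of the full subcategory `D₀[∗]` (the `baseShape` field of
`Thm44Hyp`, p.93 "`D_i := B^temp(X_i^log)[𝒟_i]`"). [cite: MochizukiEtTh2009, Thm 4.4 p.93] -/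
theorem baseShape_toy : temperedFrobenioidQ.base.Full ∧ temperedFrobenioidQ.base.Faithful ∧
    ∃ 𝒟 : Discrete PUnit.{1}, ∀ Y : Discrete PUnit.{1},
      (∃ A : Discrete PUnit.{1}, Nonempty (temperedFrobenioidQ.base.obj A ≅ Y)) ↔ Nonempty (Y ⟶ 𝒟) :=
  ⟨(inferInstance : (𝟭 (Discrete PUnit.{1})).Full), (inferInstance : (𝟭 (Discrete PUnit.{1})).Faithful),
    ⟨PUnit.unit⟩, fun Y => ⟨fun _ => ⟨⟨⟨Subsingleton.elim _ _⟩⟩⟩, fun _ => ⟨Y, ⟨Iso.refl _⟩⟩⟩⟩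

/-- **A fraction-pair with NON-trivial fraction exists in the toy** (Def 4.1 (i)): there are a birational unit
`f ∈ O^×(A_⊙^birat)` with `f · f ≠ 1` — the "uniformiser" `f_𝔭 = s_𝔭 · id⁻¹`, `s_𝔭 := (deg_Fr = 1, Base = id,
Div = 𝔭, u = (1, 𝔭)) : A_⊙ → A_⊙` with `𝔭 = 1 ∈ ℚ_{≥0}` — and a fraction-pair `(s_𝔭, id)` for it (pre-steps,
base-equivalent, `Div(id) = 0` so the supports are disjoint).  Witness data built inline (proof-only file).
[cite: MochizukiEtTh2009, Def 4.1 p.86] -/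
theorem exists_fractionPair_mul_self_ne_one :
    ∃ (f : biKummerSetting.biratUnits Aodot), f * f ≠ 1 ∧ Nonempty (biKummerSetting.FractionPair f Aodot) := by
  -- the prime `𝔭 = 1 ∈ ℚ_{≥0} = Φ(A_⊙^bs)` and the rational function `(1, 𝔭) ∈ B(A_⊙^bs)`
  let 𝔭 : temperedFrobenioidQ.Φ.carrier (op Aodot.base) := ⟨Multiplicative.ofAdd (1 : ℚ≥0), trivial⟩
  let u : temperedFrobenioidQ.ratFnFunctor.obj (op Aodot.base) :=
    ⟨(Multiplicative.ofAdd (1 : ℤ), Algebra.GrothendieckGroup.of 𝔭), by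
      change divHomQ (Multiplicative.ofAdd (1 : ℤ)) =
        temperedFrobenioidQ.ΦgpToRlog (op Aodot.base) (Algebra.GrothendieckGroup.of 𝔭)
      rw [divHomQ_ofAdd_one, TemperedFrobenioid.ΦgpToRlog, gpMap_of]
      rfl⟩
  -- the pre-step `s_𝔭 : A_⊙ → A_⊙`
  let s : Aodot ⟶ Aodot :=
    { degFr := 1, base := 𝟙 _, div := 𝔭, unit := u
      rel := by rw [PNat.one_coe, pow_one, pullGp_id]; rfl }
  have hs : biKummerSetting.IsPreStep s := ⟨rfl, (inferInstance : IsIso (𝟙 Aodot.base))⟩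
  -- its fraction against `id`
  let f : biKummerSetting.biratUnits Aodot :=
    biKummerSetting.fracOf s (𝟙 Aodot) hs (ModelFrobenioid.isPreStep_id _) rfl
  have hf : (f : (temperedFrobenioidQ.ratFnFunctor.obj (op Aodot.base))ˣ) =
      ModelFrobenioid.unitU isUnit_ratFn_Aodot s := by
    change ModelFrobenioid.frac isUnit_ratFn_Aodot s (𝟙 Aodot) = _
    rw [ModelFrobenioid.frac, show ModelFrobenioid.unitU isUnit_ratFn_Aodot (𝟙 Aodot) = 1 from Units.ext rfl,
      div_one]
  have hf1 : ((f : (temperedFrobenioidQ.ratFnFunctor.obj (op Aodot.base))ˣ).val.1).1 =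
      Multiplicative.ofAdd (1 : ℤ) := by
    rw [hf]
    rfl
  -- the fraction-pair `(s_𝔭, id)` for `f`
  let P : biKummerSetting.FractionPair f Aodot :=
    { num := s
      den := 𝟙 _
      isPreStep_num := hs
      isPreStep_den := ModelFrobenioid.isPreStep_id _
      base_eq := rfl
      frac_eq := rfl
      disjointSupports := fun x _ hx =>
        (divisorMonoidQ_isDivisorial (Discrete.mk PUnit.unit)).isSharp.eq_one_of_isUnit x
          (isUnit_of_dvd_one hx) }
  refine ⟨f, fun e => ?_, ⟨P⟩⟩
  have e3 : (((f * f : biKummerSetting.biratUnits Aodot) :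
      (temperedFrobenioidQ.ratFnFunctor.obj (op Aodot.base))ˣ).val.1).1 =
      ((1 : (temperedFrobenioidQ.ratFnFunctor.obj (op Aodot.base))ˣ).val.1).1 := by
    rw [e]; rfl
  change ((f : (temperedFrobenioidQ.ratFnFunctor.obj (op Aodot.base))ˣ).val.1).1 *
      ((f : (temperedFrobenioidQ.ratFnFunctor.obj (op Aodot.base))ˣ).val.1).1 = 1 at e3
  rw [hf1] at e3
  exact absurd (congrArg Multiplicative.toAdd e3 : (1 : ℤ) + 1 = 0) (by decide)

end Toy

namespace BiKummerSetting

open Toy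

/-! ## The universal closures of `Thm44_ii` and `Thm44_iii` are FALSE (kernel `¬ ∀`, universe level `0`) -/

/-- **F-0494 — `Thm44_ii` as typed is NOT a closed fact, lever T44-L10**: already at the cell's identity
hypothesis `Toy.thm44HypId` (`Ψ = 𝟭`, `C₁ = C₂` the perfect toy §4 setting) there is an identification `ψ`
— inversion on each `O^×(A^birat)` — for which "`Ψ` preserves fraction-pairs, `f ↦ ψ f`" fails: the
fraction-pair `(s_𝔭, id)` of the uniformiser `f_𝔭` would be a fraction-pair of `f_𝔭⁻¹` with the same arrows,
forcing `f_𝔭⁻¹ = f_𝔭`.  (Print's `Ψ^birat` is INDUCED by `Ψ` — sub-DAG row T44-L10 (b), [FrdI] Cor 4.10 —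
whereas the typed `ψ` is a free binder.) [cite: MochizukiEtTh2009, Thm 4.4 p.94] -/
theorem not_forall_thm44_ii_psi :
    ¬ ∀ (ψ : ∀ A : Toy.biKummerSetting.C,
        Toy.biKummerSetting.biratUnits A ≃* Toy.biKummerSetting.biratUnits (thm44HypId.Ψ.functor.obj A)),
        Thm44_ii thm44HypId ψ := by
  intro H
  obtain ⟨f, hf, ⟨P⟩⟩ := exists_fractionPair_mul_self_ne_one
  obtain ⟨⟨num, den, h1, h2, h3, h4, h5⟩, hn, hd⟩ :=
    H (fun A => MulEquiv.inv (Toy.biKummerSetting.biratUnits A)) f P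
  subst hn hd
  have e : f⁻¹ = f := h4.symm.trans P.frac_eq
  exact hf (inv_eq_iff_mul_eq_one.mp e)

/-- **F-0494 — the universal closure of `Thm44_ii` is FALSE (kernel `¬ ∀` over ALL its binders at universe
level `0`), lever T44-L12**: `Ψ = 𝟭`, `ψ = id` from the perfect toy §4 setting to the same setting with its free
slot "disjoint supports" set to `False` (built inline); the trivial fraction-pair `(id, id)` of `f = 1`
(`Toy.fractionPairOne`) has no image fraction-pair.  ([FrdI] Thm 4.2 (ii) "category-theoreticity of sets of
primes" is what transports the slot in print — sub-DAG row T44-L12.)  So the FACT-LIST row is a SCHEMA: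
consumable only through its instance theorems (`Thm44Hyp.thm44_ii_of_subnodes`, `thm44_ii_of_thm34`,
`thm44_ii_treeVocab`). [cite: MochizukiEtTh2009, Thm 4.4 p.94] -/
theorem not_forall_thm44_ii :
    ¬ ∀ {K : Type} [Field K] {D₀ : Type} [Category.{0} D₀] {V : FrdIMonoidStub.{0}} {K' : Type} [Field K']
        {X₁ : SemiGraphs.TemperedArithmeticGroup.{0} K} {X₂ : SemiGraphs.TemperedArithmeticGroup.{0} K'}
        {D₀' : Type} [Category.{0} D₀'] {T₁ : RealifiedDivisorMonoids (D₀ := D₀) V}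
        {T₂ : RealifiedDivisorMonoids (D₀ := D₀') V} {D₁ D₂ : Type} [Category.{0} D₁] [Category.{0} D₂]
        {VD₁ : FrdICatStub.{0, 0, 0} D₁} {VD₂ : FrdICatStub.{0, 0, 0} D₂}
        {S₁ : BiKummerSetting X₁ T₁ D₁ VD₁} {S₂ : BiKummerSetting X₂ T₂ D₂ VD₂} (h : Thm44Hyp S₁ S₂)
        (ψ : ∀ A : S₁.C, S₁.biratUnits A ≃* S₂.biratUnits (h.Ψ.functor.obj A)), Thm44_ii h ψ := by
  intro H
  -- the toy setting with the free slot `DisjointSupports := False`, and `Ψ = 𝟭` towards it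
  let S₂ : BiKummerSetting temperedGroup realifiedQ (Discrete PUnit.{1}) catVocab :=
    { biKummerSetting with DisjointSupports := fun _ _ => False }
  have hS₂ : S₂.Hodot = ⊤ := MonoidHom.ker_one
  let h : Thm44Hyp biKummerSetting S₂ :=
    { isNonDilating₁ := fun _ _ => trivial
      isNonDilating₂ := fun _ _ => trivial
      baseShape₁ := baseShape_toy
      baseShape₂ := baseShape_toy
      isOpen_Hodot₁ := by rw [hodot_eq_top, Subgroup.coe_top]; exact isOpen_univ
      isOpen_Hodot₂ := by rw [hS₂, Subgroup.coe_top]; exact isOpen_univ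
      Ψ := CategoryTheory.Equivalence.refl
      Ψbs := CategoryTheory.Equivalence.refl
      comm := biKummerSetting.base.rightUnitor ≪≫ biKummerSetting.base.leftUnitor.symm
      mapsAodot := ⟨Iso.refl _⟩ }
  obtain ⟨Q, -, -⟩ := H h (fun _ => MulEquiv.refl _) 1 fractionPairOne
  exact Q.disjointSupports

/-- **F-0495 — the universal closure of `Thm44_iii` is FALSE (kernel `¬ ∀` over ALL its binders at universe
level `0`), lever T44-L15b**: `Ψ = 𝟭`, `ψ = id` from the perfect toy §4 setting to the same setting with its
free slot "`(N, H_⊙^{bs-fld})`-saturated" set to `False` (built inline).  `A_⊙` is `H_⊙`-ample on both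
sides and `f = 1` is `H_{A_⊙}`-fixed on both sides (the v5 standing hypotheses), `A_⊙` is
`(1, H_{⊙,1}, 1)`-saturated (`Toy.isSaturated_one`), but no object of the perturbed setting satisfies
Def 4.1 (iii)(a).  (Print transports the slot by "the manifestly category-theoretic nature of
`(N, H^{bs-fld})`-saturation", [FrdII] Def 2.2 (ii) / [AbsAnab] Lem 1.3.8 — sub-DAG row T44-L15b,
`Thm44Hyp.PreservesNHSaturatedBsFld`, the one free-slot hypothesis of the tree's `thm44_iii_treeVocab`.)
So the FACT-LIST row is a SCHEMA, consumable only through `Thm44Hyp.thm44_iii_of` / `thm44_iii_of_inputs` /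
`thm44_iii_of_thm34` / `thm44_iii_treeVocab`. [cite: MochizukiEtTh2009, Thm 4.4 p.94] -/
theorem not_forall_thm44_iii :
    ¬ ∀ {K : Type} [Field K] {D₀ : Type} [Category.{0} D₀] {V : FrdIMonoidStub.{0}} {K' : Type} [Field K']
        {X₁ : SemiGraphs.TemperedArithmeticGroup.{0} K} {X₂ : SemiGraphs.TemperedArithmeticGroup.{0} K'}
        {D₀' : Type} [Category.{0} D₀'] {T₁ : RealifiedDivisorMonoids (D₀ := D₀) V}
        {T₂ : RealifiedDivisorMonoids (D₀ := D₀') V} {D₁ D₂ : Type} [Category.{0} D₁] [Category.{0} D₂]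
        {VD₁ : FrdICatStub.{0, 0, 0} D₁} {VD₂ : FrdICatStub.{0, 0, 0} D₂}
        {S₁ : BiKummerSetting X₁ T₁ D₁ VD₁} {S₂ : BiKummerSetting X₂ T₂ D₂ VD₂} (h : Thm44Hyp S₁ S₂)
        (ψ : ∀ A : S₁.C, S₁.biratUnits A ≃* S₂.biratUnits (h.Ψ.functor.obj A)), Thm44_iii h ψ := by
  intro H
  -- the toy setting with the free slot `IsNHSaturatedBsFld := False`, and `Ψ = 𝟭` towards it
  let S₂ : BiKummerSetting temperedGroup realifiedQ (Discrete PUnit.{1}) catVocab :=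
    { biKummerSetting with IsNHSaturatedBsFld := fun _ _ _ => False }
  have hS₂ : S₂.Hodot = ⊤ := MonoidHom.ker_one
  let h : Thm44Hyp biKummerSetting S₂ :=
    { isNonDilating₁ := fun _ _ => trivial
      isNonDilating₂ := fun _ _ => trivial
      baseShape₁ := baseShape_toy
      baseShape₂ := baseShape_toy
      isOpen_Hodot₁ := by rw [hodot_eq_top, Subgroup.coe_top]; exact isOpen_univ
      isOpen_Hodot₂ := by rw [hS₂, Subgroup.coe_top]; exact isOpen_univ
      Ψ := CategoryTheory.Equivalence.refl
      Ψbs := CategoryTheory.Equivalence.refl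
      comm := biKummerSetting.base.rightUnitor ≪≫ biKummerSetting.base.leftUnitor.symm
      mapsAodot := ⟨Iso.refl _⟩ }
  have hA₂ : S₂.IsAmple Toy.Aodot := ⟨trivial, fun _ _ => ⟨1, Iso.ext (Subsingleton.elim _ _)⟩⟩
  have key := H h (fun _ => MulEquiv.refl _) Toy.Aodot 1 1 isAmple_Aodot
    (fun σ _ => map_one (biKummerSetting.biratAut Toy.Aodot σ)) hA₂
    (fun σ _ => map_one (S₂.biratAut Toy.Aodot σ))
  obtain ⟨-, -, ⟨A', A'', s₁, s₂, -, -, -, hNH⟩, -⟩ := key.mp isSaturated_one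
  exact hNH

/-! ## The instance forms of (ii) that HOLD: T44-L03 derived from [FrdI] Thm 3.4; residual = the two levers -/

section General

universe u₀ v₀ u v w

variable {K : Type u₀} [Field K] {K' : Type u₀} [Field K'] {D₀ : Type u₀} [Category.{v₀} D₀]
  {V : FrdIMonoidStub.{w}}
  {X₁ : SemiGraphs.TemperedArithmeticGroup.{u₀} K} {X₂ : SemiGraphs.TemperedArithmeticGroup.{u₀} K'}
  {D₀' : Type u₀} [Category.{v₀} D₀']
  {T₁ : RealifiedDivisorMonoids (D₀ := D₀) V} {T₂ : RealifiedDivisorMonoids (D₀ := D₀') V}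
  {D₁ D₂ : Type u} [Category.{v} D₁] [Category.{v} D₂] {VD₁ : FrdICatStub.{u, v, w} D₁}
  {VD₂ : FrdICatStub.{u, v, w} D₂} {S₁ : BiKummerSetting X₁ T₁ D₁ VD₁} {S₂ : BiKummerSetting X₂ T₂ D₂ VD₂}

/-- **Thm 4.4 (ii) as typed, with the [FrdI] Thm 3.4 input DERIVED**: `Thm44_ii h ψ` ⇐ {"`C₁, C₂` are
Frobenioids", "`D₁, D₂` of FSM type", "`Φ₁, Φ₂` non-dilating" (the hypotheses under which the tree's
`Thm44Hyp.preservesFrobeniusStructure_of_thm34` (`BiKummerThm44SubFrdI.lean`) derives T44-L03 from the tree's [FrdI] Thm 3.4), T44-L10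
(`BiratCompatible ψ`: `ψ` is compatible with restriction, fractions and `Aut`-actions — i.e. IS `Ψ^birat`),
T44-L12 (`PreservesDisjointSupports`)}; via `thm44_ii_of_subnodes`.  The last two are exactly the levers of
`not_forall_thm44_ii_psi` / `not_forall_thm44_ii`. [cite: MochizukiEtTh2009, Thm 4.4 p.94] -/
theorem Thm44Hyp.thm44_ii_of_thm34 (h : Thm44Hyp S₁ S₂)
    (ψ : ∀ A : S₁.C, S₁.biratUnits A ≃* S₂.biratUnits (h.Ψ.functor.obj A))
    (hF₁ : PreFrobenioid.IsFrobenioid S₁.F) (hF₂ : PreFrobenioid.IsFrobenioid S₂.F)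
    (hD₁ : IsOfFSMType D₁) (hD₂ : IsOfFSMType D₂)
    (hnd₁ : (PreFrobenioidData.ofFunctor S₁.tf.divisorMonoid S₁.F).IsNonDilatingOn)
    (hnd₂ : (PreFrobenioidData.ofFunctor S₂.tf.divisorMonoid S₂.F).IsNonDilatingOn)
    (h10 : h.BiratCompatible ψ) (h12 : h.PreservesDisjointSupports) : Thm44_ii h ψ :=
  h.thm44_ii_of_subnodes ψ (h.preservesFrobeniusStructure_of_thm34 hF₁ hF₂ hD₁ hD₂ hnd₁ hnd₂) h10 h12

end General

section Tree

universe u₀ v₀ u v w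

variable {K : Type u₀} [Field K] {K' : Type u₀} [Field K'] {D₀ : Type u₀} [Category.{v₀} D₀]
  {X₁ : SemiGraphs.TemperedArithmeticGroup.{u₀} K} {X₂ : SemiGraphs.TemperedArithmeticGroup.{u₀} K'}
  {D₀' : Type u₀} [Category.{v₀} D₀']
  {T₁ : RealifiedDivisorMonoids (D₀ := D₀) treeMonoidVocab.{w}}
  {T₂ : RealifiedDivisorMonoids (D₀ := D₀') treeMonoidVocab.{w}}
  {D₁ D₂ : Type u} [Category.{v} D₁] [Category.{v} D₂]
  {IsRational₁ IsStrictlyRational₁ : (D₁ᵒᵖ ⥤ CommMonCat.{w}) → Prop}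
  {IsRational₂ IsStrictlyRational₂ : (D₂ᵒᵖ ⥤ CommMonCat.{w}) → Prop}
  {S₁ : BiKummerSetting X₁ T₁ D₁ (treeCatVocab D₁ IsRational₁ IsStrictlyRational₁)}
  {S₂ : BiKummerSetting X₂ T₂ D₂ (treeCatVocab D₂ IsRational₂ IsStrictlyRational₂)}

/-- **Thm 4.4 (ii) as typed at the CANONICAL [FrdI] vocabularies** (`treeMonoidVocab`, `treeCatVocab`):
`Thm44_ii h ψ` ⇐ {`Remark372 D₀`, `Remark372 D₀'` (Rmk 3.7.2: the temperoid base is connected, totally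
epimorphic, of FSM type …), `hBinj₁`, `hBinj₂` (pull-backs of `B₀^Λ` injective, Def 3.3 (iii) data), T44-L10
(`BiratCompatible ψ`), T44-L12 (`PreservesDisjointSupports`)} — "`C_i` is a Frobenioid" and "`Φ_i`
non-dilating" being the tree's `Thm44Hyp.isFrobenioid_i` / `isNonDilatingOn_ofFunctor_i` (`BiKummerThm44SubTree.lean`).  Parallel to
`thm44_iii_treeVocab` (residual T44-L15b there). [cite: MochizukiEtTh2009, Thm 4.4 p.94] -/
theorem Thm44Hyp.thm44_ii_treeVocab (h : Thm44Hyp S₁ S₂)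
    (ψ : ∀ A : S₁.C, S₁.biratUnits A ≃* S₂.biratUnits (h.Ψ.functor.obj A))
    (h372 : TemperedFrobenioid.Remark372 D₀) (h372' : TemperedFrobenioid.Remark372 D₀')
    (hBinj₁ : ∀ {Y Y' : D₀ᵒᵖ} (g : Y ⟶ Y'), Injective (T₁.BΛ.map g).hom)
    (hBinj₂ : ∀ {Y Y' : D₀'ᵒᵖ} (g : Y ⟶ Y'), Injective (T₂.BΛ.map g).hom)
    (h10 : h.BiratCompatible ψ) (h12 : h.PreservesDisjointSupports) : Thm44_ii h ψ :=
  h.thm44_ii_of_thm34 ψ (h.isFrobenioid₁ h372 hBinj₁) (h.isFrobenioid₂ h372' hBinj₂)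
    (h.isOfFSMType_base₁ h372.2.1) (h.isOfFSMType_base₂ h372'.2.1)
    h.isNonDilatingOn_ofFunctor₁ h.isNonDilatingOn_ofFunctor₂ h10 h12

end Tree

end BiKummerSetting

end Literature.AnabelianGeometry.EtaleTheta

end
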